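import Summits.Parity.GeneralizedHardyLittlewood.Theorems.LeeYangFibresCellParityLawModelPrimeSumAux
import Summits.Parity.GeneralizedHardyLittlewood.Theorems.LeeYangFibresCellParityLawRecursionIdentity
import HarnessLib

/-!
# Route `LeeYangFibres`, crux `CellParityLaw` (stmt-Parity-14109), line `section-annihilator`:
# the induction `KernelInduction` (skeleton v18) — the pointwise fibre estimate

Skeleton v18 (lead c5). The induction step `Q(n), Q(1) for the fibres ⟹ Q(n+1)` of the proof of
`stub_kernelInduction` starts from the exact recursion `C_{n+1}(𝒜; x, z) = Σ_{z<p} C_n(𝒜_p; x/p, p − 1/2)` and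
treats each fibre `𝒜_p`, `z < p ≤ x^{1/(n+1)}`, as kernel-admissible data at scale `x_p = x/p`, threshold
`z_p = p − 1/2`, deficit `η_p`. This file proves the POINTWISE estimate for one such fibre (`StepAux.fibre_pointwise`):
if the `n`-cell and the `1`-cell of `𝒜_p` obey the law with the fibre's own parity parameter
`δ_p = max 0 (2 − π_p/T_p)` (`π_p` = primes of the fibre, `T_p` its prime scale) up to errors `E_p`, `E¹_p`, then

  `|C_n(𝒜_p) − I_n(u_p) ((1 + (−1)^n) e^γ V(p) A_p(x)/u_p − (−1)^n π_p)| ≤ E_p + (u+1) E¹_p + (16(u+1)/p)(2 V(p) A_p(x) + π_p)`,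

`u_p = log(x/p)/log p` (the shift from the fibre's `u_p^s = log(x/p)/log(p − 1/2)` costs the last term, by the
Lipschitz bounds `abs_weight_sub_le`, `roughCellDensity_sub_le` of `ModelPrimeSumAux` and `FibreDataAux.shift_bounds`),
together with the clipping identity `|C₁ − (2 − δ*) T| ≤ (C₁ − 2T)⁺` behind `δ* = max 0 (2 − C₁/T)`
(`StepAux.clip_defect_le`).

References: E. Bombieri, RIMS Kôkyûroku 294 (1977) [BombieriRIMS1977].
-/

noncomputable section

open scoped BigOperators Classical
open Finset Literature.NumberTheory.Sieve

namespace Summit.Parity.GeneralizedHardyLittlewood.Cruxes.CellParityLaw.SectionAnnihilator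

namespace StepAux

/-- **Clipping.** For `C₁ ≥ 0`, `T ≥ 0` and `δ* = max 0 (2 − C₁/T)`: `0 ≤ δ* ≤ 2` and
`|C₁ − (2 − δ*) T| ≤ max 0 (C₁ − 2T)` (if `T = 0` then `δ* = 2` and both sides vanish when `C₁ = 0`; we assume
`T = 0 → C₁ = 0`). -/
theorem clip_defect_le {C₁ T : ℝ} (hC : 0 ≤ C₁) (hT : 0 ≤ T) (hTC : T = 0 → C₁ = 0) :
    0 ≤ max 0 (2 - C₁ / T) ∧ max 0 (2 - C₁ / T) ≤ 2 ∧
      |C₁ - (2 - max 0 (2 - C₁ / T)) * T| ≤ max 0 (C₁ - 2 * T) := by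
  refine ⟨le_max_left _ _, max_le (by norm_num) (by linarith [div_nonneg hC hT]), ?_⟩
  rcases eq_or_lt_of_le hT with hT0 | hTpos
  · have hC0 := hTC hT0.symm
    rw [← hT0, hC0]; simp
  · rcases le_or_gt C₁ (2 * T) with hle | hgt
    · -- unclipped: `δ* = 2 − C₁/T`, exact
      have h2 : 0 ≤ 2 - C₁ / T := by rw [sub_nonneg, div_le_iff₀ hTpos]; linarith
      rw [max_eq_right h2]
      have : C₁ - (2 - (2 - C₁ / T)) * T = 0 := by field_simp; ring
      rw [this, abs_zero]
      exact le_max_left _ _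
    · have h2 : 2 - C₁ / T ≤ 0 := by rw [sub_nonpos, le_div_iff₀ hTpos]; linarith
      rw [max_eq_left h2, sub_zero, max_eq_right (by linarith), abs_of_pos (by linarith)]

/-- The parity factors `γ_m(δ) = 1 + (δ − 1)(−1)^m` lie in `[0, 2]` for `δ ∈ [0, 2]`. -/
theorem gamma_mem {δ : ℝ} (h0 : 0 ≤ δ) (h2 : δ ≤ 2) (m : ℕ) :
    0 ≤ 1 + (δ - 1) * (-1 : ℝ) ^ m ∧ 1 + (δ - 1) * (-1 : ℝ) ^ m ≤ 2 := by
  rcases neg_one_pow_eq_or ℝ m with h | h <;> rw [h] <;> constructor <;> linarith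

/-- **The parity algebra of the step**: with `π = (2 − δ) T + e` (the fibre's prime count against its clipped
parameter, defect `e`), `γ_n(δ) T = (1 + (−1)^n) T − (−1)^n π + (−1)^n e`. -/
theorem gamma_mul_eq {δ T π e : ℝ} (hπ : π = (2 - δ) * T + e) (n : ℕ) :
    (1 + (δ - 1) * (-1 : ℝ) ^ n) * T = (1 + (-1 : ℝ) ^ n) * T - (-1 : ℝ) ^ n * π + (-1 : ℝ) ^ n * e := by
  rw [hπ]; ring

/-- **The pointwise fibre estimate.** Data: a fibre-type sequence `ℬ` (think `𝒜_p`) at scale `X` (= `x/p`) with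
two roughness parameters `1 ≤ uu ≤ us ≤ u + 1` (`u_p`, `u_p^s`) differing by `us − uu ≤ 4 us/p`, prime scale
`Ts = G V B/us` (`G = e^γ`, `V = V(p) ≥ 0`, `B = A_p(x) ≥ 0`), prime count `π ≥ 0`, `n`-cell `Cn`; hypotheses: the
`n`-cell law `|Cn − γ_n(δ) I_n(us) Ts| ≤ E` and the `1`-cell law `|π − (2 − δ) I_1(us) Ts| ≤ E1` for SOME real `δ`.
Conclusion: `|Cn − I_n(uu)((1 + (−1)^n) G V B/uu − (−1)^n π)| ≤ E + (u+1) E1 + (16(u+1)/p)(2 V B + π)`. -/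
theorem fibre_pointwise {u n : ℕ} (hn : 1 ≤ n) {p uu us V B π Cn E E1 δ : ℝ} (hp : 2 ≤ p)
    (huu : 1 ≤ uu) (hus : uu ≤ us) (husu : us ≤ (u : ℝ) + 1) (hshift : us - uu ≤ 4 * us / p)
    (hV0 : 0 ≤ V) (hB : 0 ≤ B) (hπ : 0 ≤ π)
    (hCn : |Cn - (1 + (δ - 1) * (-1 : ℝ) ^ n) * roughCellDensity n us *
        (Real.exp Real.eulerMascheroniConstant * V * B / us)| ≤ E)
    (hπ1 : |π - (2 - δ) * roughCellDensity 1 us *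
        (Real.exp Real.eulerMascheroniConstant * V * B / us)| ≤ E1) :
    |Cn - roughCellDensity n uu *
        ((1 + (-1 : ℝ) ^ n) * (Real.exp Real.eulerMascheroniConstant * V * B / uu) - (-1 : ℝ) ^ n * π)| ≤
      E + ((u : ℝ) + 1) * E1 + 16 * ((u : ℝ) + 1) / p * (2 * V * B + π) := by
  set G := Real.exp Real.eulerMascheroniConstant with hG
  have hG0 : 0 < G := Real.exp_pos _
  have hG2 : G ≤ 2 := by
    rw [hG]
    have h1 : Real.exp Real.eulerMascheroniConstant ≤ Real.exp (2 / 3) :=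
      Real.exp_le_exp.mpr Real.eulerMascheroniConstant_lt_two_thirds.le
    have h2 : Real.exp (2 / 3 : ℝ) ≤ 2 := by
      have hcube : Real.exp (2 / 3 : ℝ) ^ 3 = Real.exp 2 := by
        rw [← Real.exp_nat_mul]; norm_num
      have he : Real.exp 2 < 8 := by
        rw [show (2 : ℝ) = 1 + 1 by norm_num, Real.exp_add]
        have := Real.exp_one_lt_d9; have := Real.exp_pos (1 : ℝ); nlinarith
      by_contra hcon
      push Not at hcon
      have h3 : (2 : ℝ) ^ 3 < Real.exp (2 / 3) ^ 3 := by gcongr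
      rw [hcube] at h3
      norm_num at h3
      linarith
    exact h1.trans h2
  have hus1 : 1 ≤ us := huu.trans hus
  have hus0 : 0 < us := by linarith
  have huu0 : 0 < uu := by linarith
  have hp0 : 0 < p := by linarith
  -- `I_1(us) = 1`
  have hI1 : roughCellDensity 1 us = 1 := roughCellDensity_one_of_one_le hus1
  rw [hI1, mul_one] at hπ1
  -- bounds on `I_n`
  have hIn0 : 0 ≤ roughCellDensity n us := roughCellDensity_nonneg _ _
  have hInu : roughCellDensity n us ≤ (u : ℝ) + 1 := (roughCellDensity_le hn hus1).trans husu
  -- Step 1: replace `γ_n(δ) Ts` by `(1 + (-1)^n) Ts − (-1)^n π` at cost `I_n(us) E1`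
  set Ts := G * V * B / us with hTs
  have hTs0 : 0 ≤ Ts := by rw [hTs]; positivity
  set e := π - (2 - δ) * Ts with he
  have heE : |e| ≤ E1 := hπ1
  have hγ := gamma_mul_eq (δ := δ) (T := Ts) (π := π) (e := e) (by rw [he]; ring) n
  have h1 : |Cn - roughCellDensity n us * ((1 + (-1 : ℝ) ^ n) * Ts - (-1 : ℝ) ^ n * π)| ≤
      E + ((u : ℝ) + 1) * E1 := by
    have hsplit : Cn - roughCellDensity n us * ((1 + (-1 : ℝ) ^ n) * Ts - (-1 : ℝ) ^ n * π) =
        (Cn - (1 + (δ - 1) * (-1 : ℝ) ^ n) * roughCellDensity n us * Ts) +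
          roughCellDensity n us * ((-1 : ℝ) ^ n * e) := by
      have : (1 + (δ - 1) * (-1 : ℝ) ^ n) * roughCellDensity n us * Ts =
          roughCellDensity n us * ((1 + (δ - 1) * (-1 : ℝ) ^ n) * Ts) := by ring
      rw [this, hγ]; ring
    rw [hsplit]
    refine (abs_add_le _ _).trans (add_le_add hCn ?_)
    rw [abs_mul, abs_of_nonneg hIn0, abs_mul, abs_neg_one_pow, one_mul]
    calc roughCellDensity n us * |e| ≤ ((u : ℝ) + 1) * E1 :=
          mul_le_mul hInu heE (abs_nonneg _) (by positivity)
      _ = ((u : ℝ) + 1) * E1 := rfl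
  -- Step 2: the shift `us ↦ uu` in the two terms
  have hw : |roughCellDensity n us / us - roughCellDensity n uu / uu| ≤ 2 * (us - uu) :=
    ModelPrimeSumAux.abs_weight_sub_le hn huu hus
  have hI : roughCellDensity n us - roughCellDensity n uu ≤ us - uu :=
    ModelPrimeSumAux.roughCellDensity_sub_le hn huu hus
  have hI' : 0 ≤ roughCellDensity n us - roughCellDensity n uu :=
    sub_nonneg.mpr (monotone_roughCellDensity n hus)
  have hshift' : us - uu ≤ 4 * ((u : ℝ) + 1) / p := by
    calc us - uu ≤ 4 * us / p := hshift
      _ ≤ 4 * ((u : ℝ) + 1) / p := by gcongr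
  -- the difference of the two main expressions
  have hdiff : |roughCellDensity n us * ((1 + (-1 : ℝ) ^ n) * Ts - (-1 : ℝ) ^ n * π) -
      roughCellDensity n uu * ((1 + (-1 : ℝ) ^ n) * (G * V * B / uu) - (-1 : ℝ) ^ n * π)| ≤
      16 * ((u : ℝ) + 1) / p * (2 * V * B + π) := by
    have hsplit : roughCellDensity n us * ((1 + (-1 : ℝ) ^ n) * Ts - (-1 : ℝ) ^ n * π) -
        roughCellDensity n uu * ((1 + (-1 : ℝ) ^ n) * (G * V * B / uu) - (-1 : ℝ) ^ n * π) =
        (1 + (-1 : ℝ) ^ n) * (G * V * B) * (roughCellDensity n us / us - roughCellDensity n uu / uu) -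
          (-1 : ℝ) ^ n * π * (roughCellDensity n us - roughCellDensity n uu) := by
      rw [hTs]; field_simp; ring
    rw [hsplit]
    have hA : |(1 + (-1 : ℝ) ^ n) * (G * V * B) * (roughCellDensity n us / us - roughCellDensity n uu / uu)| ≤
        2 * (2 * V * B) * (2 * (us - uu)) := by
      rw [abs_mul, abs_mul]
      have h11 : |1 + (-1 : ℝ) ^ n| ≤ 2 := by
        rcases neg_one_pow_eq_or ℝ n with h | h <;> rw [h] <;> norm_num
      have hGVB : |G * V * B| ≤ 2 * V * B := by
        rw [abs_of_nonneg (by positivity)]; nlinarith [mul_nonneg hV0 hB]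
      have hwnn : 0 ≤ |roughCellDensity n us / us - roughCellDensity n uu / uu| := abs_nonneg _
      have hVB : 0 ≤ 2 * V * B := by have := mul_nonneg hV0 hB; linarith
      calc |1 + (-1 : ℝ) ^ n| * |G * V * B| * |roughCellDensity n us / us - roughCellDensity n uu / uu|
          ≤ 2 * (2 * V * B) * |roughCellDensity n us / us - roughCellDensity n uu / uu| := by
            apply mul_le_mul_of_nonneg_right _ hwnn
            exact mul_le_mul h11 hGVB (abs_nonneg _) (by norm_num)
        _ ≤ 2 * (2 * V * B) * (2 * (us - uu)) :=
            mul_le_mul_of_nonneg_left hw (by positivity)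
    have hBπ : |(-1 : ℝ) ^ n * π * (roughCellDensity n us - roughCellDensity n uu)| ≤ π * (us - uu) := by
      rw [abs_mul, abs_mul, abs_neg_one_pow, one_mul, abs_of_nonneg hπ, abs_of_nonneg hI']
      exact mul_le_mul_of_nonneg_left hI hπ
    calc |(1 + (-1 : ℝ) ^ n) * (G * V * B) * (roughCellDensity n us / us - roughCellDensity n uu / uu) -
          (-1 : ℝ) ^ n * π * (roughCellDensity n us - roughCellDensity n uu)|
        ≤ 2 * (2 * V * B) * (2 * (us - uu)) + π * (us - uu) := (abs_sub _ _).trans (add_le_add hA hBπ)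
      _ = (us - uu) * (8 * V * B + π) := by ring
      _ ≤ (4 * ((u : ℝ) + 1) / p) * (8 * V * B + π) := by
          have : 0 ≤ V * B := mul_nonneg hV0 hB
          gcongr
      _ ≤ 16 * ((u : ℝ) + 1) / p * (2 * V * B + π) := by
          have hup : 0 ≤ 4 * ((u : ℝ) + 1) / p := by positivity
          have key : 16 * ((u : ℝ) + 1) / p * (2 * V * B + π) - 4 * ((u : ℝ) + 1) / p * (8 * V * B + π) =
              4 * ((u : ℝ) + 1) / p * (3 * π) := by ring
          nlinarith [mul_nonneg hup (show (0 : ℝ) ≤ 3 * π by positivity)]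
  -- combine
  calc |Cn - roughCellDensity n uu * ((1 + (-1 : ℝ) ^ n) * (G * V * B / uu) - (-1 : ℝ) ^ n * π)|
      = |(Cn - roughCellDensity n us * ((1 + (-1 : ℝ) ^ n) * Ts - (-1 : ℝ) ^ n * π)) +
          (roughCellDensity n us * ((1 + (-1 : ℝ) ^ n) * Ts - (-1 : ℝ) ^ n * π) -
            roughCellDensity n uu * ((1 + (-1 : ℝ) ^ n) * (G * V * B / uu) - (-1 : ℝ) ^ n * π))| := by
        ring_nf
    _ ≤ E + ((u : ℝ) + 1) * E1 + 16 * ((u : ℝ) + 1) / p * (2 * V * B + π) :=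
        (abs_add_le _ _).trans (add_le_add h1 hdiff)

/-- **The parity algebra at the parent.** With the clip defect `cd`, `(2 − δ) T = C₁ − cd`:
`(1 + (−1)^n) S_T − (−1)^n S_π − γ_{n+1}(δ) I T
 = (1 + (−1)^n)(S_T − I T) − (−1)^n (S_π − I (2T − C₁)) + (−1)^n I cd`. -/
theorem parent_algebra {ST Sπ T C₁ δ I cd : ℝ} (hcd : (2 - δ) * T = C₁ - cd) (n : ℕ) :
    (1 + (-1 : ℝ) ^ n) * ST - (-1 : ℝ) ^ n * Sπ - (1 + (δ - 1) * (-1 : ℝ) ^ (n + 1)) * I * T =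
      (1 + (-1 : ℝ) ^ n) * (ST - I * T) - (-1 : ℝ) ^ n * (Sπ - I * (2 * T - C₁)) +
        (-1 : ℝ) ^ n * I * cd := by
  have hC : C₁ = (2 - δ) * T + cd := by linarith
  rw [hC, pow_succ]
  ring

/-- The parent bound from the parity algebra:
`|(1 + (−1)^n) S_T − (−1)^n S_π − γ_{n+1}(δ) I T| ≤ 2|S_T − IT| + |S_π − I(2T − C₁)| + I |cd|` (`I ≥ 0`). -/
theorem parent_bound {ST Sπ T C₁ δ I cd : ℝ} (hcd : (2 - δ) * T = C₁ - cd) (hI : 0 ≤ I) (n : ℕ) :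
    |(1 + (-1 : ℝ) ^ n) * ST - (-1 : ℝ) ^ n * Sπ - (1 + (δ - 1) * (-1 : ℝ) ^ (n + 1)) * I * T| ≤
      2 * |ST - I * T| + |Sπ - I * (2 * T - C₁)| + I * |cd| := by
  rw [parent_algebra hcd n]
  have h11 : |1 + (-1 : ℝ) ^ n| ≤ 2 := by
    rcases neg_one_pow_eq_or ℝ n with h | h <;> rw [h] <;> norm_num
  have hA : |(1 + (-1 : ℝ) ^ n) * (ST - I * T)| ≤ 2 * |ST - I * T| := by
    rw [abs_mul]; exact mul_le_mul_of_nonneg_right h11 (abs_nonneg _)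
  have hB : |(-1 : ℝ) ^ n * (Sπ - I * (2 * T - C₁))| = |Sπ - I * (2 * T - C₁)| := by
    rw [abs_mul, abs_neg_one_pow, one_mul]
  have hC : |(-1 : ℝ) ^ n * I * cd| = I * |cd| := by
    rw [abs_mul, abs_mul, abs_neg_one_pow, one_mul, abs_of_nonneg hI]
  calc |(1 + (-1 : ℝ) ^ n) * (ST - I * T) - (-1 : ℝ) ^ n * (Sπ - I * (2 * T - C₁)) + (-1 : ℝ) ^ n * I * cd|
      ≤ |(1 + (-1 : ℝ) ^ n) * (ST - I * T) - (-1 : ℝ) ^ n * (Sπ - I * (2 * T - C₁))| + |(-1 : ℝ) ^ n * I * cd| :=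
        abs_add_le _ _
    _ ≤ (|(1 + (-1 : ℝ) ^ n) * (ST - I * T)| + |(-1 : ℝ) ^ n * (Sπ - I * (2 * T - C₁))|) + |(-1 : ℝ) ^ n * I * cd| :=
        add_le_add_left (abs_sub _ _) _
    _ ≤ 2 * |ST - I * T| + |Sπ - I * (2 * T - C₁)| + I * |cd| := by rw [hB, hC]; linarith

/-- **`weightedPairSum` through the fibres' prime counts**:
`Σ_{q ≤ x, Ω(q)=2, P⁻(q)>z} a_q I_n(u_{P⁻(q)}) = Σ_{z<p≤x} I_n(u_p) C_1(𝒜_p; x/p, p − 1/2)` (the weighted Buchstab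
recursion at `j = 1`). -/
theorem weightedPairSum_eq_sum_fibre (𝒜 : SieveSequence) (x z : ℝ) (n : ℕ) :
    weightedPairSum 𝒜 x z n =
      ∑ p ∈ (Finset.Ioc 0 ⌊x⌋₊).filter (fun p : ℕ => p.Prime ∧ z < (p : ℝ)),
        roughCellDensity n (Real.log (x / p) / Real.log p) *
          roughCellSum (fibreSeq 𝒜 p) (x / p) ((p : ℝ) - 1 / 2) 1 := by
  rw [← sum_roughCell_succ_eq_sum_fibre 𝒜 x z 1 le_rfl
    (fun p : ℕ => roughCellDensity n (Real.log (x / p) / Real.log p))]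
  unfold weightedPairSum
  refine Finset.sum_congr rfl fun q _ => ?_
  ring

/-- The cells are sub-sums of the size: `0 ≤ C_m(𝒜; x, z) ≤ A(x)` when `A(x) = Σ_{n ≤ x} a_n`. -/
theorem roughCellSum_le_size (𝒜 : SieveSequence) (x z : ℝ) (m : ℕ)
    (hsize : ∀ y : ℝ, 𝒜.size y = 𝒜.congrSum 1 y) :
    0 ≤ roughCellSum 𝒜 x z m ∧ roughCellSum 𝒜 x z m ≤ 𝒜.size x := by
  unfold roughCellSum
  refine ⟨Finset.sum_nonneg fun q _ => 𝒜.a_nonneg q, ?_⟩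
  rw [hsize, SieveSequence.congrSum, Finset.filter_true_of_mem fun n _ => one_dvd n]
  exact Finset.sum_le_sum_of_subset_of_nonneg (Finset.filter_subset _ _) fun q _ _ => 𝒜.a_nonneg q

/-- The size is at most `x`: `A(x) = Σ_{1 ≤ n ≤ x} a_n ≤ ⌊x⌋ ≤ x` (weights `≤ 1`, `x ≥ 0`). -/
theorem size_le_self (𝒜 : SieveSequence) {x : ℝ} (hx : 0 ≤ x) (ha : ∀ q : ℕ, 𝒜.a q ≤ 1)
    (hsize : ∀ y : ℝ, 𝒜.size y = 𝒜.congrSum 1 y) : 𝒜.size x ≤ x := by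
  rw [hsize, SieveSequence.congrSum, Finset.filter_true_of_mem fun n _ => one_dvd n]
  calc ∑ n ∈ Finset.Ioc 0 ⌊x⌋₊, 𝒜.a n ≤ ∑ _n ∈ Finset.Ioc 0 ⌊x⌋₊, (1 : ℝ) := Finset.sum_le_sum fun n _ => ha n
    _ = ⌊x⌋₊ := by simp
    _ ≤ x := Nat.floor_le hx

/-- **`stub_parentBound`** (registered auxiliary sub-goal of stmt-Parity-14109, induction of skeleton v18): the
parity algebra at the parent — `|(1 + (−1)^n) S_T − (−1)^n S_π − γ_{n+1}(δ) I T| ≤ 2|S_T − IT| + |S_π − I(2T − C₁)| + I|cd|`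
whenever `(2 − δ) T = C₁ − cd` and `I ≥ 0`. -/
theorem stub_parentBound : ∀ (ST Sπ T C₁ δ I cd : ℝ), (2 - δ) * T = C₁ - cd → 0 ≤ I → ∀ n : ℕ,
    |(1 + (-1 : ℝ) ^ n) * ST - (-1 : ℝ) ^ n * Sπ - (1 + (δ - 1) * (-1 : ℝ) ^ (n + 1)) * I * T| ≤
      2 * |ST - I * T| + |Sπ - I * (2 * T - C₁)| + I * |cd| :=
  fun _ _ _ _ _ _ _ hcd hI n => parent_bound hcd hI n

end StepAux

end Summit.Parity.GeneralizedHardyLittlewood.Cruxes.CellParityLaw.SectionAnnihilator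

end
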